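import Mathlib

/-!
# Tier7/Line1/SepWeight — restricted tensor products of qubits, as functions on `Finset ℕ`

Infrastructure for the SEPARATING DATUM of t7-L1-p2 (LINE L1, residual probe): two algebraically simple,
non-isomorphic modules over the «Pauli operators» (bit flips `flip n` and signs `sgn n`) inside `ℓ²(Finset ℕ)`,
pairing non-trivially under the `ℓ²` inner product. For a weight sequence `s : ℕ → ℂ` the module `Wmod s` is the
union over finite `N ⊆ ℕ` of the «level-`N`» functions `ω ↦ F (ω ∩ N) * ∏_{n ∈ ω \ N} s n`; `Wmod 0` is the space of
finitely supported functions (the restricted tensor product `⊗'(ℂ², e₀)`), `Wmod s` for `s n ≠ 0` is `⊗'(ℂ², (1, s n))`.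
This file: the operators, the weights, the levels, and the stability of `Wmod s` under all flips and signs.
Continued in `SepWeightSimple` (simplicity), `SepWeightFix` («Fix» lemmas, `ℓ²`) and `SepWeightComm` (commutant).
No number theory here; `import Mathlib` only.
Author: t7-L1-p2 (prover-pub-hodge-repro2-t7-L1-p2-g0-0). §8(d): NO.
-/

namespace Summit.Ventures.HodgeRepro2.Tier7.Line1.Sep

open Finset

noncomputable section


/-- configurations: finite sets of excited qubits -/
abbrev Ω := Finset ℕ

/-- the bit-flip operator at qubit `n` -/
def flip (n : ℕ) (f : Ω → ℂ) : Ω → ℂ := fun ω => f (symmDiff ω {n})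

/-- the sign operator at qubit `n` -/
def sgn (n : ℕ) (f : Ω → ℂ) : Ω → ℂ := fun ω => (if n ∈ ω then (-1 : ℂ) else 1) * f ω

/-- the weight `∏_{n ∈ ω} s n` of a configuration -/
def wt (s : ℕ → ℂ) (ω : Ω) : ℂ := ∏ n ∈ ω, s n

/-- the empty configuration has weight `1` -/
@[simp] theorem wt_empty (s : ℕ → ℂ) : wt s ∅ = 1 := by simp [wt]

/-- the weight of `insert n ω` -/
theorem wt_insert (s : ℕ → ℂ) {n : ℕ} {ω : Ω} (h : n ∉ ω) : wt s (insert n ω) = s n * wt s ω := by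
  simp [wt, Finset.prod_insert h]

/-- the weight is multiplicative on disjoint unions -/
theorem wt_union (s : ℕ → ℂ) {ω₁ ω₂ : Ω} (h : Disjoint ω₁ ω₂) :
    wt s (ω₁ ∪ ω₂) = wt s ω₁ * wt s ω₂ := by
  simp [wt, Finset.prod_union h]

/-- the norm of a weight is the product of the norms -/
theorem norm_wt (s : ℕ → ℂ) (ω : Ω) : ‖wt s ω‖ = ∏ n ∈ ω, ‖s n‖ := by
  simp [wt, norm_prod]

/-! ## Linear structure of the operators -/

/-- `flip n` is additive -/
theorem flip_add (n : ℕ) (f g : Ω → ℂ) : flip n (f + g) = flip n f + flip n g := by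
  funext ω; simp [flip]

/-- `flip n` is homogeneous -/
theorem flip_smul (n : ℕ) (c : ℂ) (f : Ω → ℂ) : flip n (c • f) = c • flip n f := by
  funext ω; simp [flip]

/-- `flip n` kills `0` -/
theorem flip_zero (n : ℕ) : flip n (0 : Ω → ℂ) = 0 := by
  funext ω; simp [flip]

/-- `flip n` is an involution -/
theorem flip_flip (n : ℕ) (f : Ω → ℂ) : flip n (flip n f) = f := by
  funext ω; simp [flip, symmDiff_symmDiff_cancel_right]

/-- `sgn n` is additive -/
theorem sgn_add (n : ℕ) (f g : Ω → ℂ) : sgn n (f + g) = sgn n f + sgn n g := by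
  funext ω; simp [sgn, mul_add]

/-- `sgn n` is homogeneous -/
theorem sgn_smul (n : ℕ) (c : ℂ) (f : Ω → ℂ) : sgn n (c • f) = c • sgn n f := by
  funext ω; simp [sgn]

/-- `sgn n` kills `0` -/
theorem sgn_zero (n : ℕ) : sgn n (0 : Ω → ℂ) = 0 := by
  funext ω; simp [sgn]

/-- `sgn n` is an involution -/
theorem sgn_sgn (n : ℕ) (f : Ω → ℂ) : sgn n (sgn n f) = f := by
  funext ω; by_cases h : n ∈ ω <;> simp [sgn, h]

/-- the projection `π_n^+ = (1 + Z_n)/2` onto functions vanishing on configurations containing `n` -/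
def proj (n : ℕ) (f : Ω → ℂ) : Ω → ℂ := fun ω => if n ∈ ω then 0 else f ω

/-- the projection `π_n^- = (1 - Z_n)/2` onto functions supported on configurations containing `n` -/
def projc (n : ℕ) (f : Ω → ℂ) : Ω → ℂ := fun ω => if n ∈ ω then f ω else 0

/-- `proj n = (1 + Z_n)/2` -/
theorem proj_eq (n : ℕ) (f : Ω → ℂ) : proj n f = (1 / 2 : ℂ) • (f + sgn n f) := by
  funext ω; simp only [proj, sgn, Pi.smul_apply, Pi.add_apply, smul_eq_mul]; split_ifs <;> ring

/-- `projc n = (1 - Z_n)/2` -/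
theorem projc_eq (n : ℕ) (f : Ω → ℂ) : projc n f = (1 / 2 : ℂ) • (f - sgn n f) := by
  funext ω; simp only [projc, sgn, Pi.smul_apply, Pi.sub_apply, smul_eq_mul]; split_ifs <;> ring

/-- the two projections sum to the identity -/
theorem proj_add_projc (n : ℕ) (f : Ω → ℂ) : proj n f + projc n f = f := by
  funext ω; simp only [proj, projc, Pi.add_apply]; split_ifs <;> simp

/-! ## Stable subspaces -/

/-- a subspace stable under all flips and all signs -/
structure Stable (Q : Submodule ℂ (Ω → ℂ)) : Prop where
  flip_mem : ∀ n, ∀ f ∈ Q, flip n f ∈ Q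
  sgn_mem : ∀ n, ∀ f ∈ Q, sgn n f ∈ Q

/-- a stable subspace is stable under `proj n` -/
theorem Stable.proj_mem {Q : Submodule ℂ (Ω → ℂ)} (hQ : Stable Q) (n : ℕ) {f : Ω → ℂ} (hf : f ∈ Q) :
    proj n f ∈ Q := by
  rw [proj_eq]; exact Q.smul_mem _ (Q.add_mem hf (hQ.sgn_mem n f hf))

/-- a stable subspace is stable under `projc n` -/
theorem Stable.projc_mem {Q : Submodule ℂ (Ω → ℂ)} (hQ : Stable Q) (n : ℕ) {f : Ω → ℂ} (hf : f ∈ Q) :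
    projc n f ∈ Q := by
  rw [projc_eq]; exact Q.smul_mem _ (Q.sub_mem hf (hQ.sgn_mem n f hf))

/-! ## Level spaces -/

/-- the level-`N` functions of weight `s`: `ω ↦ F (ω ∩ N) * wt s (ω \ N)` -/
def level (s : ℕ → ℂ) (N : Finset ℕ) : Submodule ℂ (Ω → ℂ) where
  carrier := {f | ∃ F : Finset ℕ → ℂ, ∀ ω, f ω = F (ω ∩ N) * wt s (ω \ N)}
  add_mem' := by
    rintro f g ⟨F, hF⟩ ⟨G, hG⟩
    exact ⟨F + G, fun ω => by simp [hF ω, hG ω, add_mul]⟩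
  zero_mem' := ⟨0, fun ω => by simp⟩
  smul_mem' := by
    rintro c f ⟨F, hF⟩
    exact ⟨c • F, fun ω => by simp [hF ω, mul_assoc]⟩

/-- membership in a level, unfolded -/
theorem mem_level {s : ℕ → ℂ} {N : Finset ℕ} {f : Ω → ℂ} :
    f ∈ level s N ↔ ∃ F : Finset ℕ → ℂ, ∀ ω, f ω = F (ω ∩ N) * wt s (ω \ N) := Iff.rfl

/-- the weight itself is of level `∅` -/
theorem wt_mem_level (s : ℕ → ℂ) : wt s ∈ level s ∅ :=
  ⟨fun _ => 1, fun ω => by simp⟩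

/-- the weight is not the zero function (it is `1` at `∅`) -/
theorem wt_ne_zero (s : ℕ → ℂ) : wt s ≠ 0 := by
  intro h
  have := congrFun h ∅
  simp at this

/-- levels are monotone in `N` -/
theorem level_mono {s : ℕ → ℂ} {N M : Finset ℕ} (h : N ⊆ M) : level s N ≤ level s M := by
  rintro f ⟨F, hF⟩
  refine ⟨fun A => F (A ∩ N) * wt s (A \ N), fun ω => ?_⟩
  rw [hF ω]
  have h1 : ω ∩ M ∩ N = ω ∩ N := by
    ext x; simp only [mem_inter]; constructor
    · rintro ⟨⟨h1, _⟩, h2⟩; exact ⟨h1, h2⟩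
    · rintro ⟨h1, h2⟩; exact ⟨⟨h1, h h2⟩, h2⟩
  have h2 : ω \ N = ((ω ∩ M) \ N) ∪ (ω \ M) := by
    ext x; simp only [mem_sdiff, mem_inter, mem_union]
    constructor
    · rintro ⟨h1, h2⟩
      by_cases hx : x ∈ M
      · exact Or.inl ⟨⟨h1, hx⟩, h2⟩
      · exact Or.inr ⟨h1, hx⟩
    · rintro (⟨⟨h1, _⟩, h2⟩ | ⟨h1, h2⟩)
      · exact ⟨h1, h2⟩
      · exact ⟨h1, fun hx => h2 (h hx)⟩
  have hd : Disjoint ((ω ∩ M) \ N) (ω \ M) := by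
    rw [Finset.disjoint_left]
    intro x hx hx'
    simp only [mem_sdiff, mem_inter] at hx hx'
    exact hx'.2 hx.1.2
  show F (ω ∩ N) * wt s (ω \ N) = F (ω ∩ M ∩ N) * wt s ((ω ∩ M) \ N) * wt s (ω \ M)
  rw [h1, h2, wt_union s hd]
  ring

/-- the levels form a directed family -/
theorem level_directed (s : ℕ → ℂ) : Directed (· ≤ ·) (level s) := fun N N' =>
  ⟨N ∪ N', level_mono subset_union_left, level_mono subset_union_right⟩

/-- the module of weight `s`: the union of all levels -/
def Wmod (s : ℕ → ℂ) : Submodule ℂ (Ω → ℂ) := ⨆ N, level s N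

/-- every level lies in `Wmod s` -/
theorem level_le_Wmod (s : ℕ → ℂ) (N : Finset ℕ) : level s N ≤ Wmod s := le_iSup (level s) N

/-- membership in `Wmod s` = membership in some level -/
theorem mem_Wmod_iff {s : ℕ → ℂ} {f : Ω → ℂ} : f ∈ Wmod s ↔ ∃ N, f ∈ level s N :=
  Submodule.mem_iSup_of_directed _ (level_directed s)

/-- `Wmod s` is not zero -/
theorem Wmod_ne_bot (s : ℕ → ℂ) : Wmod s ≠ ⊥ := by
  intro h
  have : wt s ∈ Wmod s := level_le_Wmod s ∅ (wt_mem_level s)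
  rw [h, Submodule.mem_bot] at this
  exact wt_ne_zero s this

/-! ## Stability of the levels -/

/-- flipping a qubit of `N` commutes with `· ∩ N` -/
theorem inter_symmDiff_singleton {ω N : Finset ℕ} {n : ℕ} (hn : n ∈ N) :
    symmDiff ω {n} ∩ N = symmDiff (ω ∩ N) {n} := by
  ext x
  simp only [mem_inter, Finset.mem_symmDiff, mem_singleton]
  rcases eq_or_ne x n with rfl | hx
  · simp [hn]
  · simp [hx]

/-- flipping a qubit of `N` does not change `· \ N` -/
theorem sdiff_symmDiff_singleton {ω N : Finset ℕ} {n : ℕ} (hn : n ∈ N) :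
    symmDiff ω {n} \ N = ω \ N := by
  ext x
  simp only [mem_sdiff, Finset.mem_symmDiff, mem_singleton]
  rcases eq_or_ne x n with rfl | hx
  · simp [hn]
  · simp [hx]

/-- a level is stable under the flips of its own qubits -/
theorem flip_mem_level {s : ℕ → ℂ} {N : Finset ℕ} {n : ℕ} (hn : n ∈ N) {f : Ω → ℂ}
    (hf : f ∈ level s N) : flip n f ∈ level s N := by
  obtain ⟨F, hF⟩ := hf
  refine ⟨fun A => F (symmDiff A {n}), fun ω => ?_⟩
  simp only [flip, hF (symmDiff ω {n}), inter_symmDiff_singleton hn, sdiff_symmDiff_singleton hn]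

/-- a level is stable under the signs of its own qubits -/
theorem sgn_mem_level {s : ℕ → ℂ} {N : Finset ℕ} {n : ℕ} (hn : n ∈ N) {f : Ω → ℂ}
    (hf : f ∈ level s N) : sgn n f ∈ level s N := by
  obtain ⟨F, hF⟩ := hf
  refine ⟨fun A => (if n ∈ A then (-1 : ℂ) else 1) * F A, fun ω => ?_⟩
  have : n ∈ ω ∩ N ↔ n ∈ ω := by simp [hn]
  simp only [sgn, hF ω, this]
  ring

/-- `Wmod s` is stable under all flips and signs -/
theorem Wmod_stable (s : ℕ → ℂ) : Stable (Wmod s) where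
  flip_mem := by
    intro n f hf
    obtain ⟨N, hN⟩ := mem_Wmod_iff.1 hf
    refine mem_Wmod_iff.2 ⟨insert n N, flip_mem_level (mem_insert_self n N) ?_⟩
    exact level_mono (subset_insert n N) hN
  sgn_mem := by
    intro n f hf
    obtain ⟨N, hN⟩ := mem_Wmod_iff.1 hf
    refine mem_Wmod_iff.2 ⟨insert n N, sgn_mem_level (mem_insert_self n N) ?_⟩
    exact level_mono (subset_insert n N) hN

end

end Summit.Ventures.HodgeRepro2.Tier7.Line1.Sep
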